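import Mathlib
import HarnessLib
import Summits.NavierStokesRegularity.NavierStokesRegularity.Theorems.UnthreadedDoorCellFluxDefs
import Summits.NavierStokesRegularity.NavierStokesRegularity.Theorems.UnthreadedDoorCellFluxCellHeadCoherent

/-!
# Route `UnthreadedDoor`, crux `PoloidalLiouville` (stmt-NavierStokesRegularity-1222), WALL W1 — crux idea «cell-flux»:
# THE FINEST RULE (CELLS) SATISFIES EVERY STATIC CLAUSE OF `AdmissibleRule` ON THE ANALYTIC COUNT-FREE STRATUM, BY NAME

Support file (seat leafhand-ns-unthreadeddoor-3 g7, cell decomp-ns), `--supports stmt-NavierStokesRegularity-1222 --as helper`; theorems only.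

`AdmissibleRule x₀ T P V t₀ 𝒞` (`…UnthreadedDoorCellFluxDefs`) asks, at every `(t, r)` of the window: (1) `𝒞 t r` is a CLUSTER PARTITION
(finitely many pairwise disjoint nonempty classes, each a union of cells, covering `S_r ∖ Γ`), (2) every class is HEAD-COHERENT with constant
`r · V t`, (4) `#classes ≤ #cells`; and, across `(t, r)`: (3) the cluster flux is JOINTLY CONTINUOUS; Λ-1 `HeadClusterRuleTame` adds that the
classes have PRECONNECTED RANGES.  For the finest rule `𝒞 t r := cellSet (T t) x₀ r` the static clauses (1), (2), (4) and the range clause hold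
at every slice with finitely many cells and finitely many isolated critical points (`cellFinitePred`):

* `mem_cellOf_self`, `cellOf_eq_of_mem`, `isClusterPartition_cellSet` — clause (1) for the cells of a finite cell set;
* `isPreconnected_image_cellOf` — the range `T '' K` of a cell is preconnected (a cell is preconnected, `T` continuous off `x₀`);
* ★★ `finestRule_static` — clauses (1), (2) (from `headCoherent_cellOf_of_linked_analytic`, p829178), (4) and the range clause, in the binders
  of Λ-1, for ONE slice.

WHAT THIS IS NOT: clause (3) FAILS for the finest rule in general (the cell flux jumps at same-type reconnections of sheet traces — the card's
no-go; head-CLUSTERS group cells to restore continuity), so this is the base case of Λ-1's construction, not Λ-1.  Λ-1, Λ-2, Σ-0bR₂, Σ-0e, C⁻,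
`PoloidalLiouville` (1222), W1 and NS regularity stay OPEN; no summit statement is proved. [folklore]
-/

noncomputable section

set_option linter.dupNamespace false

open Set Function Filter Topology Metric
open scoped RealInnerProductSpace

namespace Summit.NavierStokesRegularity.NavierStokesRegularity.Theorems.PoloidalLiouville.CellFlux

open Summit.NavierStokesRegularity.NavierStokesRegularity.Theorems.PoloidalLiouville.NetFlux (E3)
open Literature.Analysis Literature.Analysis.FluidPDE

variable {f : E3 → ℝ} {x₀ : E3} {r : ℝ}

/-! ### 1. Cells form a cluster partition -/

/-- A point of `S_r(x₀) ∖ Γ` lies in its own cell. [folklore] -/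
theorem mem_cellOf_self {x : E3} (hx : x ∈ Metric.sphere x₀ r \ sheetTrace f x₀ r) : x ∈ cellOf f x₀ r x :=
  mem_connectedComponentIn hx

/-- Cells through a common point coincide. [folklore] -/
theorem cellOf_eq_of_mem {x y : E3} (hy : y ∈ cellOf f x₀ r x) : cellOf f x₀ r x = cellOf f x₀ r y :=
  connectedComponentIn_eq hy

/-- **The cells of `S_r(x₀) ∖ Γ` form a cluster partition** (clause (1) of `AdmissibleRule` for the finest rule), as soon as there are
finitely many of them. [folklore] -/
theorem isClusterPartition_cellSet (hfin : (cellSet f x₀ r).Finite) : IsClusterPartition f x₀ r (cellSet f x₀ r) := by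
  refine ⟨hfin, ?_, ?_, ?_⟩
  · rintro K ⟨x, hx, rfl⟩
    exact ⟨⟨x, mem_cellOf_self hx⟩, {cellOf f x₀ r x}, by
      rintro _ ⟨⟩
      exact ⟨x, hx, rfl⟩, (sUnion_singleton _).symm⟩
  · apply Subset.antisymm
    · rintro y ⟨K, ⟨x, hx, rfl⟩, hyK⟩
      exact connectedComponentIn_subset _ _ hyK
    · intro y hy
      exact ⟨cellOf f x₀ r y, ⟨y, hy, rfl⟩, mem_cellOf_self hy⟩
  · rintro K ⟨x, hx, rfl⟩ K' ⟨x', hx', rfl⟩ hne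
    rw [Function.onFun, disjoint_iff_inter_eq_empty]
    by_contra h
    obtain ⟨z, hz, hz'⟩ := nonempty_iff_ne_empty.2 h
    exact hne ((cellOf_eq_of_mem hz).trans (cellOf_eq_of_mem hz').symm)

/-- **The range of a cell is preconnected** (`T` continuous off `x₀`, `r > 0`). [folklore] -/
theorem isPreconnected_image_cellOf (hr : 0 < r) (hf : ContinuousOn f ({x₀}ᶜ : Set E3)) (x : E3) :
    IsPreconnected (f '' cellOf f x₀ r x) := by
  refine isPreconnected_connectedComponentIn.image f (hf.mono ?_)
  intro z hz
  have hzS : z ∈ Metric.sphere x₀ r := (connectedComponentIn_subset _ _ hz).1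
  intro h0
  rw [mem_singleton_iff] at h0
  have := mem_sphere_iff_norm.1 hzS
  rw [h0, sub_self, norm_zero] at this
  exact hr.ne' this.symm

/-! ### 2. ★★ The static clauses of admissibility for the finest rule, one slice -/

/-- ★★ **Finest rule, static clauses, in Λ-1's binders (one instant).**  `v` analytic on `ℝ³` with `‖v‖ ≤ V` on `S_r(x₀)` (`r > 0`), `T`
analytic and `P ∈ C¹` off `x₀`, head relation `(∇P − ⟪v, · − x₀⟫ ∇T) × (x − x₀) = 0` on the sphere, finitely many cells and finitely many
isolated sphere-critical points on `S_r(x₀)`.  Then the cell set is a cluster partition, every cell is head-coherent with constant `r·V`,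
every cell has a preconnected range, and (trivially) the class count is the cell count — clauses (1), (2), (4) of `AdmissibleRule` and the
range clause of `HeadClusterRuleTame` for `𝒞 t r := cellSet (T t) x₀ r` at this slice.  (Clause (3), joint continuity, is NOT claimed.)
[folklore] -/
theorem finestRule_static {v : E3 → E3} {T P : E3 → ℝ} {x₀ : E3} {r V : ℝ} (hr : 0 < r)
    (hv : AnalyticOnNhd ℝ v (univ : Set E3)) (hT : AnalyticOnNhd ℝ T ({x₀}ᶜ : Set E3))
    (hP : ContDiffOn ℝ 1 P ({x₀}ᶜ : Set E3))
    (hV : ∀ x ∈ Metric.sphere x₀ r, ‖v x‖ ≤ V)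
    (hhead : ∀ x ∈ Metric.sphere x₀ r, cross (gradient P x - ⟪v x, x - x₀⟫ • gradient T x) (x - x₀) = 0)
    (hcells : (cellSet T x₀ r).Finite) (hiso : (isoCrit T x₀ r).Finite) :
    IsClusterPartition T x₀ r (cellSet T x₀ r) ∧
      (∀ K ∈ cellSet T x₀ r, HeadCoherent T P (r * V) K) ∧
      (∀ K ∈ cellSet T x₀ r, IsPreconnected (T '' K)) ∧
      (cellSet T x₀ r).ncard ≤ (cellSet T x₀ r).ncard := by
  refine ⟨isClusterPartition_cellSet hcells, ?_, ?_, le_rfl⟩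
  · rintro K ⟨x, -, rfl⟩
    exact headCoherent_cellOf_of_linked_analytic hr hv hT hP hV hhead hiso x
  · rintro K ⟨x, -, rfl⟩
    exact isPreconnected_image_cellOf hr hT.continuousOn x

end Summit.NavierStokesRegularity.NavierStokesRegularity.Theorems.PoloidalLiouville.CellFlux

end
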